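import Literature.Combinatorics.Sahi2008.FixedCycle

/-!
# Permutations with a distinguished union of cycles are pairs of permutations: the two-sided gluing decomposition of
# `Sym(κ)` (support file for the all-order charge monotonicity of the slot-pattern kernel)

Support file of the one-cut programme (crux `NoHeavyLowerTail`, stmt-CriticalPhenomena-4575; cell `prim-masterthm`, seat P3,
gen 29; `run/shared/lean/prim/prim-masterthm/prim-masterthm-p3/HIERARCHY.md` §36).

Lieb–Sahi's "`σ = c · τ`, `τ` a permutation of `J_c`" (`Literature…Sahi2008.FixedCycle`: `CycleForm.glue B cB τ`, the cycles
of a glued permutation when `cB` is ONE cycle) is generalised here to an ARBITRARY permutation `α` of the inside `U`: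
* `orbit_glue_of_mem'`, `image_orbit_glue_eq_in/out` — the cycles of `glue U α β` are the embedded cycles of `α`
  (through the points of `U`) and of `β` (through the points off `U`);
* `stable_iff_exists_glue` — a permutation stabilises `U` iff it is glued; `glue_injective₂`;
* the bookkeeping of "a sub-collection `W` of the cycles of `τ`" versus "a `τ`-stable set `U = ⋃ W`"
  (`mem_biUnion_iff_apply_mem`, `image_orbit_biUnion`, `orbits_sdiff_eq_image`, `biUnion_image_orbit`);
* **`sum_powerset_orbits`** — THE DECOMPOSITION: for every `F`,
  `Σ_{τ ∈ Sym κ} Σ_{W ⊆ cycles τ} F(W, cycles τ ∖ W) = Σ_{U ⊆ κ} Σ_{α ∈ Sym U} Σ_{β ∈ Sym Uᶜ} F(cycles α, cycles β)`.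
The sequel `…SahiSlotCycleWeights` derives from it the identity of cycle-weight sums
`Σ_τ Π_{c}(1 + ω c) = Σ_τ [Π_c ω c + Σ_e Π_{c ≠ cycle of e} ω c]` that turns the pinned slot-pattern kernel into a manifestly
monotone "top-cell" form at every order.  Everything here is proved; axioms standard. [this work]
-/

noncomputable section

namespace Summit.CriticalPhenomena.PercolationContinuityZ3.Theorems

open Finset Function Equiv Equiv.Perm
open Literature.Combinatorics.Sahi2008 Literature.Combinatorics.Sahi2008.CycleForm

namespace SahiSlot

/-- On a finite type, `SameCycle σ x y` iff `σ^k x = y` for some `k : ℕ`. [folklore] -/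
theorem sameCycle_iff_exists_nat_pow {β : Type*} [Finite β] {σ : Perm β} {x y : β} :
    SameCycle σ x y ↔ ∃ k : ℕ, (σ ^ k) x = y :=
  ⟨fun h => h.exists_nat_pow_eq, fun ⟨k, hk⟩ => ⟨k, by simpa using hk⟩⟩

variable {κ : Type*} [Fintype κ] [DecidableEq κ]

/-! ### Cycles: small bookkeeping -/

/-- A member of `orbits τ` is the cycle through some point. [folklore] -/
theorem exists_eq_orbit_of_mem_orbits {τ : Perm κ} {c : Finset κ} (hc : c ∈ orbits τ) : ∃ y, c = orbit τ y := by
  unfold orbits at hc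
  obtain ⟨y, -, rfl⟩ := mem_image.1 hc
  exact ⟨y, rfl⟩

/-- The points whose cycle is a given cycle are the points of that cycle. [folklore] -/
theorem filter_orbit_eq_self {τ : Perm κ} {c : Finset κ} (hc : c ∈ orbits τ) :
    univ.filter (fun e => orbit τ e = c) = c := by
  obtain ⟨y, rfl⟩ := exists_eq_orbit_of_mem_orbits hc
  ext e
  simp only [mem_filter, mem_univ, true_and]
  constructor
  · intro h
    rw [← h]
    exact self_mem_orbit τ e
  · intro h
    exact (orbit_eq_orbit_of_sameCycle (mem_orbit.1 h)).symm

omit [Fintype κ] [DecidableEq κ] in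
/-- Iterates of a permutation stay inside a stable set. [folklore] -/
theorem pow_apply_mem_of_stable {τ : Perm κ} {U : Finset κ} (hU : ∀ x, x ∈ U ↔ τ x ∈ U) {x : κ} (hx : x ∈ U)
    (k : ℕ) : (τ ^ k) x ∈ U := by
  induction k with
  | zero => simpa using hx
  | succ k ih =>
    rw [pow_succ', Perm.mul_apply]
    exact (hU _).1 ih

/-! ### Cycles of a two-sided glued permutation -/

omit [Fintype κ] in
/-- Powers of a glued permutation are glued powers. [folklore] -/
theorem glue_pow_eq (U : Finset κ) (α : Perm {x // x ∈ U}) (β : Perm {x // x ∉ U}) (k : ℕ) :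
    glue U α β ^ k = glue U (α ^ k) (β ^ k) := by
  change subtypeCongrHom (fun x => x ∈ U) (α, β) ^ k = subtypeCongrHom (fun x => x ∈ U) (α ^ k, β ^ k)
  rw [← map_pow, Prod.pow_mk]

/-- The cycle of a glued permutation through a point of `U` is the embedded cycle of the inside permutation `α`
(no cyclicity assumption on `α`; companion of `CycleForm.orbit_glue_of_not_mem`). [this work] -/
theorem orbit_glue_of_mem' (U : Finset κ) (α : Perm {x // x ∈ U}) (β : Perm {x // x ∉ U}) {x : κ} (hx : x ∈ U) :
    orbit (glue U α β) x = (orbit α ⟨x, hx⟩).map (Embedding.subtype _) := by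
  ext y
  rw [mem_orbit, mem_map, sameCycle_iff_exists_nat_pow]
  constructor
  · rintro ⟨k, rfl⟩
    refine ⟨(α ^ k) ⟨x, hx⟩, mem_orbit.2 (sameCycle_iff_exists_nat_pow.2 ⟨k, rfl⟩), ?_⟩
    rw [glue_pow_eq, glue_apply_mem _ _ hx]
    rfl
  · rintro ⟨z, hz, rfl⟩
    obtain ⟨k, hk⟩ := sameCycle_iff_exists_nat_pow.1 (mem_orbit.1 hz)
    refine ⟨k, ?_⟩
    rw [glue_pow_eq, glue_apply_mem _ _ hx, hk]
    rfl

/-- The cycles of `glue U α β` through the points of `U` are the cycles of `α`. [this work] -/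
theorem image_orbit_glue_eq_in (U : Finset κ) (α : Perm {x // x ∈ U}) (β : Perm {x // x ∉ U}) :
    U.image (orbit (glue U α β)) = (orbits α).image (Finset.map (Embedding.subtype _)) := by
  ext O
  simp only [orbits, mem_image, mem_univ, true_and]
  constructor
  · rintro ⟨x, hx, rfl⟩
    exact ⟨orbit α ⟨x, hx⟩, ⟨⟨x, hx⟩, rfl⟩, (orbit_glue_of_mem' U α β hx).symm⟩
  · rintro ⟨O', ⟨z, rfl⟩, rfl⟩
    exact ⟨z, z.2, orbit_glue_of_mem' U α β z.2⟩

/-- The cycles of `glue U α β` through the points off `U` are the cycles of `β`. [this work] -/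
theorem image_orbit_glue_eq_out (U : Finset κ) (α : Perm {x // x ∈ U}) (β : Perm {x // x ∉ U}) :
    (univ \ U).image (orbit (glue U α β)) = (orbits β).image (Finset.map (Embedding.subtype _)) := by
  ext O
  simp only [orbits, mem_image, mem_univ, true_and, mem_sdiff]
  constructor
  · rintro ⟨x, hx, rfl⟩
    exact ⟨orbit β ⟨x, hx⟩, ⟨⟨x, hx⟩, rfl⟩, (orbit_glue_of_not_mem α β hx).symm⟩
  · rintro ⟨O', ⟨z, rfl⟩, rfl⟩
    exact ⟨z, z.2, orbit_glue_of_not_mem α β z.2⟩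

omit [Fintype κ] in
/-- A permutation stabilises `U` iff it is a glued permutation. [this work] -/
theorem stable_iff_exists_glue {τ : Perm κ} {U : Finset κ} :
    (∀ x, x ∈ U ↔ τ x ∈ U) ↔ ∃ p : Perm {x // x ∈ U} × Perm {x // x ∉ U}, glue U p.1 p.2 = τ := by
  constructor
  · intro h
    have h' : ∀ x, x ∉ U ↔ τ x ∉ U := fun x => not_congr (h x)
    refine ⟨(τ.subtypePerm fun x => (h x).symm, τ.subtypePerm fun x => (h' x).symm), ?_⟩
    ext x
    by_cases hx : x ∈ U
    · rw [glue_apply_mem _ _ hx, subtypePerm_apply]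
    · rw [glue_apply_not_mem _ _ hx, subtypePerm_apply]
  · rintro ⟨⟨α, β⟩, rfl⟩ x
    by_cases hx : x ∈ U
    · rw [glue_apply_mem _ _ hx]
      exact ⟨fun _ => (α ⟨x, hx⟩).2, fun _ => hx⟩
    · rw [glue_apply_not_mem _ _ hx]
      exact ⟨fun h => absurd h hx, fun h => absurd h (β ⟨x, hx⟩).2⟩

omit [Fintype κ] in
/-- The pair (inside, outside) is determined by the glued permutation. [folklore] -/
theorem glue_injective₂ (U : Finset κ) :
    Function.Injective (fun p : Perm {x // x ∈ U} × Perm {x // x ∉ U} => glue U p.1 p.2) :=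
  fun _ _ h => subtypeCongrHom_injective (fun x => x ∈ U) h

/-! ### Sub-collections of cycles versus stable sets -/

/-- A union of cycles of `τ` is `τ`-stable. [folklore] -/
theorem mem_biUnion_iff_apply_mem {τ : Perm κ} {W : Finset (Finset κ)} (hW : W ⊆ orbits τ) (x : κ) :
    x ∈ W.biUnion id ↔ τ x ∈ W.biUnion id := by
  simp only [mem_biUnion, id]
  constructor
  · rintro ⟨c, hc, hx⟩
    obtain ⟨y, rfl⟩ := exists_eq_orbit_of_mem_orbits (hW hc)
    exact ⟨orbit τ y, hc, mem_orbit.2 (sameCycle_apply_right.2 (mem_orbit.1 hx))⟩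
  · rintro ⟨c, hc, hx⟩
    obtain ⟨y, rfl⟩ := exists_eq_orbit_of_mem_orbits (hW hc)
    exact ⟨orbit τ y, hc, mem_orbit.2 (sameCycle_apply_right.1 (mem_orbit.1 hx))⟩

/-- The cycles through the points of `⋃ W` are the members of `W` (for `W` a collection of cycles). [folklore] -/
theorem image_orbit_biUnion {τ : Perm κ} {W : Finset (Finset κ)} (hW : W ⊆ orbits τ) :
    (W.biUnion id).image (orbit τ) = W := by
  ext c
  simp only [mem_image, mem_biUnion, id]
  constructor
  · rintro ⟨x, ⟨c', hc', hx⟩, rfl⟩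
    obtain ⟨y, rfl⟩ := exists_eq_orbit_of_mem_orbits (hW hc')
    rwa [← orbit_eq_orbit_of_sameCycle (mem_orbit.1 hx)]
  · intro hc
    obtain ⟨y, rfl⟩ := exists_eq_orbit_of_mem_orbits (hW hc)
    exact ⟨y, ⟨orbit τ y, hc, self_mem_orbit τ y⟩, rfl⟩

/-- The remaining cycles are the cycles through the points off `⋃ W`. [folklore] -/
theorem orbits_sdiff_eq_image {τ : Perm κ} {W : Finset (Finset κ)} (hW : W ⊆ orbits τ) :
    orbits τ \ W = (univ \ W.biUnion id).image (orbit τ) := by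
  ext c
  simp only [mem_sdiff, mem_image, mem_univ, true_and, mem_biUnion, id, not_exists, not_and]
  constructor
  · rintro ⟨hc, hcW⟩
    obtain ⟨y, rfl⟩ := exists_eq_orbit_of_mem_orbits hc
    refine ⟨y, fun c' hc' hy => hcW ?_, rfl⟩
    obtain ⟨z, rfl⟩ := exists_eq_orbit_of_mem_orbits (hW hc')
    rwa [orbit_eq_orbit_of_sameCycle (mem_orbit.1 hy)] at hc'
  · rintro ⟨y, hy, rfl⟩
    exact ⟨orbit_mem_orbits τ y, fun hyW => hy _ hyW (self_mem_orbit τ y)⟩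

/-- A stable set is the union of the cycles through its points. [folklore] -/
theorem biUnion_image_orbit {τ : Perm κ} {U : Finset κ} (hU : ∀ x, x ∈ U ↔ τ x ∈ U) :
    (U.image (orbit τ)).biUnion id = U := by
  ext z
  simp only [mem_biUnion, mem_image, id]
  constructor
  · rintro ⟨c, ⟨x, hx, rfl⟩, hz⟩
    obtain ⟨k, rfl⟩ := sameCycle_iff_exists_nat_pow.1 (mem_orbit.1 hz)
    exact pow_apply_mem_of_stable hU hx k
  · intro hz
    exact ⟨orbit τ z, ⟨z, hz, rfl⟩, self_mem_orbit τ z⟩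

/-! ### The decomposition -/

/-- **Two-sided gluing decomposition of `Sym(κ)` with a distinguished union of cycles**: for every `F`,
`Σ_{τ} Σ_{W ⊆ cycles τ} F(W, cycles τ ∖ W) = Σ_{U} Σ_{α ∈ Sym U} Σ_{β ∈ Sym Uᶜ} F(cycles α, cycles β)`
— a permutation together with a sub-collection of its cycles is the same as a subset `U` with a permutation of `U` and one of
its complement. [this work] -/
theorem sum_powerset_orbits (F : Finset (Finset κ) → Finset (Finset κ) → ℝ) :
    ∑ τ : Perm κ, ∑ W ∈ (orbits τ).powerset, F W (orbits τ \ W) =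
      ∑ U : Finset κ, ∑ α : Perm {x // x ∈ U}, ∑ β : Perm {x // x ∉ U},
        F ((orbits α).image (Finset.map (Embedding.subtype _))) ((orbits β).image (Finset.map (Embedding.subtype _))) := by
  classical
  -- Step 1: (τ, W) ↦ (U = ⋃ W, τ), inverse (U, τ) ↦ (τ, cycles of τ through U)
  have step1 : ∑ τ : Perm κ, ∑ W ∈ (orbits τ).powerset, F W (orbits τ \ W) =
      ∑ U : Finset κ, ∑ τ ∈ univ.filter (fun τ : Perm κ => ∀ x, x ∈ U ↔ τ x ∈ U),
        F (U.image (orbit τ)) ((univ \ U).image (orbit τ)) := by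
    have eL : ∑ τ : Perm κ, ∑ W ∈ (orbits τ).powerset, F W (orbits τ \ W) =
        ∑ x ∈ (univ : Finset (Perm κ)).sigma (fun τ => (orbits τ).powerset), F x.2 (orbits x.1 \ x.2) :=
      (Finset.sum_sigma univ (fun τ : Perm κ => (orbits τ).powerset) (fun x => F x.2 (orbits x.1 \ x.2))).symm
    have eR : ∑ U : Finset κ, ∑ τ ∈ univ.filter (fun τ : Perm κ => ∀ x, x ∈ U ↔ τ x ∈ U),
        F (U.image (orbit τ)) ((univ \ U).image (orbit τ)) =
        ∑ y ∈ (univ : Finset (Finset κ)).sigma (fun U => univ.filter (fun τ : Perm κ => ∀ x, x ∈ U ↔ τ x ∈ U)),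
          F (y.1.image (orbit y.2)) ((univ \ y.1).image (orbit y.2)) :=
      (Finset.sum_sigma univ (fun U : Finset κ => univ.filter (fun τ : Perm κ => ∀ x, x ∈ U ↔ τ x ∈ U))
        (fun y => F (y.1.image (orbit y.2)) ((univ \ y.1).image (orbit y.2)))).symm
    rw [eL, eR]
    refine Finset.sum_bij' (fun x _ => ⟨x.2.biUnion id, x.1⟩) (fun y _ => ⟨y.2, y.1.image (orbit y.2)⟩)
      ?_ ?_ ?_ ?_ ?_
    · rintro ⟨τ, W⟩ hx
      have hW : W ⊆ orbits τ := mem_powerset.1 (mem_sigma.1 hx).2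
      exact mem_sigma.2 ⟨mem_univ _, mem_filter.2 ⟨mem_univ _, mem_biUnion_iff_apply_mem hW⟩⟩
    · rintro ⟨U, τ⟩ hy
      exact mem_sigma.2 ⟨mem_univ _, mem_powerset.2 (image_subset_iff.2 fun x _ => orbit_mem_orbits τ x)⟩
    · rintro ⟨τ, W⟩ hx
      have hW : W ⊆ orbits τ := mem_powerset.1 (mem_sigma.1 hx).2
      simp only [image_orbit_biUnion hW]
    · rintro ⟨U, τ⟩ hy
      have hU : ∀ x, x ∈ U ↔ τ x ∈ U := (mem_filter.1 (mem_sigma.1 hy).2).2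
      simp only [biUnion_image_orbit hU]
    · rintro ⟨τ, W⟩ hx
      have hW : W ⊆ orbits τ := mem_powerset.1 (mem_sigma.1 hx).2
      simp only [image_orbit_biUnion hW, orbits_sdiff_eq_image hW]
  -- Step 2: the stable permutations of `U` are the glued ones
  have step2 : ∀ U : Finset κ, ∑ τ ∈ univ.filter (fun τ : Perm κ => ∀ x, x ∈ U ↔ τ x ∈ U),
      F (U.image (orbit τ)) ((univ \ U).image (orbit τ)) =
      ∑ α : Perm {x // x ∈ U}, ∑ β : Perm {x // x ∉ U},
        F ((orbits α).image (Finset.map (Embedding.subtype _))) ((orbits β).image (Finset.map (Embedding.subtype _))) := by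
    intro U
    have hset : univ.filter (fun τ : Perm κ => ∀ x, x ∈ U ↔ τ x ∈ U) =
        (univ : Finset (Perm {x // x ∈ U} × Perm {x // x ∉ U})).image (fun p => glue U p.1 p.2) := by
      ext τ
      simp only [mem_filter, mem_univ, true_and, mem_image]
      exact stable_iff_exists_glue
    rw [hset, sum_image (fun p _ q _ h => glue_injective₂ U h), Fintype.sum_prod_type]
    refine Fintype.sum_congr _ _ fun α => Fintype.sum_congr _ _ fun β => ?_
    rw [image_orbit_glue_eq_in, image_orbit_glue_eq_out]
  rw [step1]
  exact Fintype.sum_congr _ _ step2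

end SahiSlot

end Summit.CriticalPhenomena.PercolationContinuityZ3.Theorems
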